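/-
Copyright (c) 2026 the pub-hodgecm-mathlib formalisation cell (harness21).  Prover seat hodgecm-mathlib-K2E3-p14 (g9), Track B «K2-LIT» ∕ h413 =
`stmt-HodgeConjecture-24833`, line `K2_E3_EllipticInputs`, unit U4 «Keys», PART «U4Keys» socket :182 (U4f-χ₁-ram-one-pos), programme A_pos^{<}
(default offer BY NAME on the K2 bus 2026-09-04T22:33:33Z; LINE-LEAD K2E3-plan (g5); partition K2E3-p34 (g2) memo `K2/K2E3-p34/g2/CENSUS-Apos-lt-shells.md` §3 last bullet):
brick (iii′)^{<}-B «DEPTH WITNESSES ON THE UPPER `b`-SHELLS OF THE BIG CELL FOR THE TWO-DEPTH GROUP `J_e`» — the long-root twin, read on the UPPER side, of ★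
`K2E3LevelNDepthWitnessZ` (K2E3-p37 (g0)).  REPORT-FIRST 2026-09-04.
-/
import Summits.HodgeConjecture.HodgeConjecture.Theorems.K2E3LowerUnipotentBigCellIntegral     -- ★ p861613 (K2E3-p37): `exists_upper_of_rel` (`u(a,b) ∈ N`); brings ★ BigCell (`exists_coe_eq_lower`), ★ `coe_inv_apply_eq`, ★ `weylLongU_mul_mul_weylLongU_mem_unipotentU`
import Summits.HodgeConjecture.HodgeConjecture.Theorems.K2E3IwahoriTwoDepthFactorisation      -- ★ p862387 (this seat): the letters `(e, Jg, hJg)`, `v_uniformiser_le_one`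
import HarnessLib

/-!
# K2 ∕ E3 «EllipticInputs», unit U4 «Keys» — (U4f-χ₁-ram-one-pos), programme A_pos^{<} brick (iii′)^{<}-B: DEPTH WITNESSES ON THE UPPER `b`-SHELLS `w·u(a,b)·J_e` OF THE BIG CELL
# «for `u(a,b) ∈ N ∩ K₀` off `J_e` through its long-root coordinate `b`, the lower long-root element `ū(0, z̄)`, `z̄ = (c′b + t₁c′·aσa)∕(bσb)`, conjugates into `J_e` with `(0,0)` entry
# `(1 + c′)(1 + ε)`, `ε ∈ 𝔭ⁿ`»   [Roche1998 §4; Casselman1995 §6.3; Rogawski1990 §1.10]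

Cell hodgecm-mathlib, Track B «K2-LIT», crux item H413 = stmt-HodgeConjecture-24833 (route `HCCMUnconditional`, no route verbs); serves BY NAME the OPEN tier-0 leaf
`…K2E3EllipticInputs.U4Keys.sig_K2E3KeysThmTwoContractingRamifiedCharOnePosDepth` (U4Keys :182), design D-I at POSITIVE depth in the regime A_pos^{<}.  Author K2E3-p14 (g9).
`--supports stmt-HodgeConjecture-24833 --as helper`; THEOREMS ONLY (no `def` ∕ `instance` ∕ `notation` ∕ named fact ∕ `sorry`); MODEL level (`U(σ, Φ₃)(K)`; letters `σ hJ hσ hvσ hvϖ` of ★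
and `(e, Jg, hJg)` of ★ p862387; trace-one letter `t₁` of ★ `K2E3LevelNDepthWitnessTraceOne`).  NOT THE PAYER of :182.

THE POINT.  In the cell-family engine ★ `K2E3BranchAContradictionCells` with `B = J_e` (★ p862387), the big cell `ū(x,z) = p·w·u(x∕z, 1∕z)` (★ p861613) no longer lies in `P·w·J_e`
when `u′ := u(a, b) := u(x∕z, 1∕z) ∈ N ∩ K₀` is off `J_e` (upper depths `e 0 1` on `a`, `e 0 2` on `b`; K2E3-p34 (g2) memo §2): the UPPER SHELLS `r₀ = w·u′`, absent for the uniform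
`J_n`.  A witness for `r₀` is `b₀ ∈ J_e` with `r₀ b₀ r₀⁻¹ ∈ P` and `θ(b₀) ≠ τ(r₀ b₀ r₀⁻¹)`; with `b₀ := u′⁻¹ n̄ u′`, `n̄ ∈ N̄`, one has `r₀ b₀ r₀⁻¹ = w n̄ w⁻¹ ∈ N` (`τ = 1`) and
`θ(b₀) = χ₁((b₀)₀₀)` (★ p862455 ∕ ★ p862449).  THIS FILE treats the `b`-SHELLS (`|a| ≤ |ϖ|^{e 0 1}` but `b` too shallow) by the LONG-ROOT lower element `n̄ = ū(0, z̄)`: since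
`n̄ − 1 = z̄·e₂e₀ᵀ`, `b₀ − 1 = z̄·(u′⁻¹e₂)(e₀ᵀu′) = z̄·(σb, σa, 1)ᵀ(1, a, b)` (§1, exact, any field), so `(b₀)₀₀ = 1 + z̄σb` and `b₀ ∈ J_e` is a list of nine valuation bounds (§2).
The choice `z̄ := (c′b + t₁c′·aσa)∕(bσb)` (`σc′ = c′`, `t₁ + σt₁ = 1`) is EXACTLY trace-zero (`z̄ + σz̄ = c′(b + σb + aσa)∕(bσb) = 0`, so `ū(0, z̄) ∈ U`), and `z̄σb = c′ + t₁c′aσa∕b`, whence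
`(b₀)₀₀ = (1 + c′)(1 + ε)`, `ε = t₁c′aσa∕(b(1 + c′))`, `|ε| ≤ |c′||a|²∕|b|`; and `|z̄|·|b| ≤ |c′|` (as `|a|² ≤ |b|`).  The bounds are stated as a VALUATION BUDGET (`H01 H02 H10 H20 Hn`,
products of `|c′|, |a|, |b|` against `|ϖ|^{e i j}`), discharged by the CM dress from `ord a ≥ r`, `ord b ≤ s − 1`, `ord c′ ≤ c − 1` and Roche's `s + s' = c`, `s' ≥ r' − r`, `c ≥ s + 1`,
`2r + c ≥ n + s` (memo §3; all hold for `(⌊n∕2⌋, ⌊c∕2⌋, ⌈n∕2⌉, ⌈c∕2⌉)`, `c ≥ 2` — for `c = 1` there is no `b`-shell).  With `χ₁(1 + c′) ≠ 1` (the failure of `hcondF` at depth `c − 1`) and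
`χ₁ = 1` on `1 + 𝔭ⁿ`, the cell `P·w·u′·J_e` is θ-IRRELEVANT.
* §1 (any field) `coe_inv_upper_eq` (`u(a,b)⁻¹ = !![1, −a, σb; 0, 1, σa; 0, 0, 1]`), **`coe_conj_lower_long_eq`** (the matrix of `u′⁻¹ ū(0,z̄) u′`), `longRoot_rel` (`z̄ + σz̄ = 0`),
  `longRoot_mul_conj` (`z̄σb = c′ + t₁c′aσa∕b`).
* §2 (valued) **`exists_upperShellB_witness`**: `∃ n̄ ∈ N.map (conj w), u′⁻¹ n̄ u′ ∈ Jg ∧ ∃ ε, |ε| ≤ |ϖ|ⁿ ∧ (u′⁻¹ n̄ u′)₀₀ = (1 + c′)(1 + ε)`; `conj_weylLongU_mul_eq` (`(w u′) b₀ (w u′)⁻¹ = w n̄ w⁻¹`).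
HONEST LABEL: HC_CM is proved only modulo the 7 printed citations (2 remaining named inputs: hLiu418 = stmt-HodgeConjecture-24832, h413 = stmt-HodgeConjecture-24833)
until rung 0 closes; count-neutral — this file does NOT pay the leaf; no printed citation is discharged.

## References
* [Roche1998] A. Roche, *Types and Hecke algebras for principal series representations of split reductive p-adic groups*, Ann. Sci. ÉNS (4) 31 (1998), §4 (support of `χ̃`-spherical vectors).
* [Casselman1995] W. Casselman, *Introduction to the theory of admissible representations of `p`-adic reductive groups* (1995), §6.3.
* [Rogawski1990] J. D. Rogawski, *Automorphic Representations of Unitary Groups in Three Variables*, Ann. of Math. Stud. 123 (1990), §1.9–§1.10 pp. 8–9.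
-/

set_option autoImplicit false
-- the mandated namespace repeats the single-problem summit's segment (`HodgeConjecture.HodgeConjecture`)
set_option linter.dupNamespace false

noncomputable section

open Matrix Literature.NumberTheory.Automorphic Literature.NumberTheory.Automorphic.UnitaryGroup
open scoped Matrix MatrixGroups WithZero Pointwise

namespace Summit.HodgeConjecture.HodgeConjecture.Cruxes.H413.K2E3TwoDepthUpperShellWitnessB

open Summit.HodgeConjecture.HodgeConjecture.Cruxes.H413

/-! ## §1 Algebra over any field with an involution: `u(a,b)⁻¹ · ū(0, z̄) · u(a,b)` -/

section Algebra

variable {K : Type*} [Field K] (σ : K →+* K) {J : Matrix (Fin 3) (Fin 3) K} (hJ : J = (StdForm.antidiagonal 3).over K)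
  (hσ : ∀ a, σ (σ a) = a)
  {u nb : ↥(unitaryGroupOfForm σ J)} {a b zb : K}
  (hu : ((u : GL (Fin 3) K) : Matrix (Fin 3) (Fin 3) K) = !![1, a, b; 0, 1, -σ a; 0, 0, 1])
  (hnb : ((nb : GL (Fin 3) K) : Matrix (Fin 3) (Fin 3) K) = !![1, 0, 0; -σ 0, 1, 0; zb, 0, 1])

include hJ hσ hu in
/-- **The matrix of `u(a, b)⁻¹` is `!![1, −a, σb; 0, 1, σa; 0, 0, 1]`** (`(g⁻¹)ᵢⱼ = σ(g_{rev j, rev i})`, ★ `coe_inv_apply_eq`). [cite: Rogawski1990, §1.9 p. 8] -/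
theorem coe_inv_upper_eq :
    (((u⁻¹ : ↥(unitaryGroupOfForm σ J)) : GL (Fin 3) K) : Matrix (Fin 3) (Fin 3) K) = !![1, -a, σ b; 0, 1, σ a; 0, 0, 1] := by
  ext i j
  rw [coe_inv_apply_eq σ hJ u i j, hu]
  fin_cases i <;> fin_cases j <;> simp [hσ]

include hJ hσ hu hnb in
/-- **The matrix of `b₀ = u(a,b)⁻¹ · ū(0, z̄) · u(a,b)`** for `u(a,b) ∈ N` (`b + σb + aσa = 0`): `b₀ − 1 = z̄·(σb, σa, 1)ᵀ(1, a, b)`, i.e.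
`b₀ = !![1 + z̄σb, z̄σb·a, z̄σb·b; z̄σa, 1 + z̄σa·a, z̄σa·b; z̄, z̄a, 1 + z̄b]` (the `(0,2)` entry uses the relation once). [cite: Rogawski1990, §1.10 p. 9] [cite: Roche1998, §4] -/
theorem coe_conj_lower_long_eq (hrel : b + σ b + a * σ a = 0) :
    (((u⁻¹ * nb * u : ↥(unitaryGroupOfForm σ J)) : GL (Fin 3) K) : Matrix (Fin 3) (Fin 3) K) =
      !![1 + zb * σ b, zb * σ b * a, zb * σ b * b; zb * σ a, 1 + zb * σ a * a, zb * σ a * b; zb, zb * a, 1 + zb * b] := by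
  rw [Subgroup.coe_mul, Subgroup.coe_mul, Units.val_mul, Units.val_mul, coe_inv_upper_eq σ hJ hσ hu, hnb, hu]
  ext i j
  fin_cases i <;> fin_cases j <;>
    simp only [Matrix.mul_apply, Fin.sum_univ_three, Fin.zero_eta, Fin.mk_one, Fin.reduceFinMk, Fin.isValue, Matrix.of_apply, Matrix.cons_val',
      Matrix.cons_val_zero, Matrix.cons_val_one, Matrix.cons_val, Matrix.empty_val', Matrix.cons_val_fin_one, map_zero, neg_zero] <;>
    first | linear_combination hrel | ring

omit hJ in
include hσ in
/-- **The long-root coordinate `z̄ = (c′b + t₁c′·aσa)∕(bσb)` is EXACTLY trace-zero**: `z̄ + σz̄ = c′(b + σb + aσa)∕(bσb) = 0` for `σc′ = c′`, `t₁ + σt₁ = 1` and `u(a,b) ∈ N`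
(`b + σb + aσa = 0`), so `ū(0, z̄) ∈ U(σ, Φ₃)` (★ `exists_coe_eq_lower` with `p = 0`). [cite: Rogawski1990, §1.10 p. 9] -/
theorem longRoot_rel {c' t₁ : K} (hrel : b + σ b + a * σ a = 0) (hb0 : b ≠ 0) (hσc' : σ c' = c') (ht₁ : t₁ + σ t₁ = 1)
    (hzb : zb = (c' * b + t₁ * c' * (a * σ a)) / (b * σ b)) :
    zb + σ zb + 0 * σ 0 = 0 := by
  have hσb0 : σ b ≠ 0 := (map_ne_zero σ).2 hb0
  have hσt₁ : σ t₁ = 1 - t₁ := by linear_combination ht₁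
  rw [hzb, map_div₀, map_add, map_mul, map_mul, map_mul, map_mul, map_mul, hσ, hσ, hσc', hσt₁, map_zero, mul_zero, add_zero]
  rw [div_add_div _ _ (mul_ne_zero hb0 hσb0) (mul_ne_zero hσb0 hb0), div_eq_zero_iff]
  left
  linear_combination (b * σ b) * c' * hrel

/-- **`z̄·σb = c′ + t₁c′aσa∕b`** for `z̄ = (c′b + t₁c′·aσa)∕(bσb)` — the `(0,0)` entry of `b₀` is `1 + z̄σb = (1 + c′)(1 + ε)`, `ε = t₁c′aσa∕(b(1+c′))`. [cite: Roche1998, §4] -/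
theorem longRoot_mul_conj {c' t₁ : K} (hb0 : b ≠ 0) (hσb0 : σ b ≠ 0) (hzb : zb = (c' * b + t₁ * c' * (a * σ a)) / (b * σ b)) :
    zb * σ b = c' + t₁ * c' * (a * σ a) / b := by
  rw [hzb]
  field_simp

end Algebra

/-! ## §2 The witness on an upper `b`-shell -/

section Valued

variable {K : Type*} [Field K] [Valued K ℤᵐ⁰] [ValuativeRel K] [(Valued.v : Valuation K ℤᵐ⁰).Compatible]
  (σ : K →+* K) {ϖ : K} {J : Matrix (Fin 3) (Fin 3) K} (hJ : J = (StdForm.antidiagonal 3).over K)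
  (hσ : ∀ a, σ (σ a) = a) (hvσ : ∀ a, Valued.v (σ a) = Valued.v a) (hvϖ : Valued.v ϖ = WithZero.exp (-1 : ℤ))
  (e : Fin 3 → Fin 3 → ℕ) (Jg : Subgroup ↥(unitaryGroupOfForm σ J))
  (hJg : ∀ k, k ∈ Jg ↔ ∀ i j, Valued.v (((k : GL (Fin 3) K) : Matrix (Fin 3) (Fin 3) K) i j) ≤ Valued.v ϖ ^ e i j)

omit [Valued K ℤᵐ⁰] [ValuativeRel K] [(Valued.v : Valuation K ℤᵐ⁰).Compatible] in
include hJ in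
/-- `(w u′)·(u′⁻¹ n̄ u′)·(w u′)⁻¹ = w n̄ w⁻¹`: the representative `r₀ = w·u′` of an upper shell conjugates the witness `b₀ = u′⁻¹ n̄ u′` back to `w n̄ w⁻¹ ∈ N ⊂ P`, on which
`τ = χδ^{½}` is `1` — the engine's clause `r₀ b₀ r₀⁻¹ ∈ P`. [cite: Roche1998, §4] [cite: Casselman1995, §6.3] -/
theorem conj_weylLongU_mul_eq (u nb : ↥(unitaryGroupOfForm σ J)) :
    weylLongU σ hJ * u * (u⁻¹ * nb * u) * (weylLongU σ hJ * u)⁻¹ = weylLongU σ hJ * nb * (weylLongU σ hJ)⁻¹ := by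
  group

omit [Valued K ℤᵐ⁰] [ValuativeRel K] [(Valued.v : Valuation K ℤᵐ⁰).Compatible] in
include hJ in
/-- `w n̄ w⁻¹ ∈ N` for a LOWER unitriangular `n̄` (`w² = 1`, ★ `weylLongU_mul_mul_weylLongU_mem_unipotentU`). [cite: Rogawski1990, §1.10 p. 9] -/
theorem weylLongU_mul_mul_inv_mem_unipotentU {nb : ↥(unitaryGroupOfForm σ J)}
    (hlow : ∀ i j : Fin 3, i < j → ((nb : GL (Fin 3) K) : Matrix (Fin 3) (Fin 3) K) i j = 0)
    (hdiag : ∀ i : Fin 3, ((nb : GL (Fin 3) K) : Matrix (Fin 3) (Fin 3) K) i i = 1) :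
    weylLongU σ hJ * nb * (weylLongU σ hJ)⁻¹ ∈ unipotentU σ J := by
  rw [inv_eq_of_mul_eq_one_right (weylLongU_mul_weylLongU σ hJ)]
  exact weylLongU_mul_mul_weylLongU_mem_unipotentU σ hJ hlow hdiag

omit [ValuativeRel K] [(Valued.v : Valuation K ℤᵐ⁰).Compatible] in
include hJ hσ hvσ hJg in
/-- **THE `b`-SHELL WITNESS.**  Let `u′ = u(a, b) ∈ N ∩ K₀` (`|a|, |b| ≤ 1`, `b + σb + aσa = 0`, `b ≠ 0`), `c′` `σ`-FIXED with `|c′| < 1`, `t₁` trace-one (`t₁ + σt₁ = 1`, `|t₁| ≤ 1`),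
and assume the VALUATION BUDGET against the exponent matrix `e` (`e i i = 0`, anti-transpose symmetric):
`H01 : |c′||a| ≤ |ϖ|^{e 0 1}`, `H02 : |c′||b| ≤ |ϖ|^{e 0 2}`, `H10 : |c′||a| ≤ |ϖ|^{e 1 0}|b|`, `H20 : |c′| ≤ |ϖ|^{e 2 0}|b|`, `Hn : |c′||a|² ≤ |ϖ|ⁿ|b|`.
Then the lower long-root element `n̄ = ū(0, z̄)`, `z̄ = (c′b + t₁c′·aσa)∕(bσb)`, lies in `N̄ = N.map (conj w)` (and `w n̄ w⁻¹ ∈ N`), `b₀ := u′⁻¹ n̄ u′ ∈ J_e`, and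
`(b₀)₀₀ = (1 + c′)(1 + ε)` with `|ε| ≤ |ϖ|ⁿ` — so `θ(b₀) = χ₁(1 + c′) ≠ 1 = τ((wu′) b₀ (wu′)⁻¹)` for `χ₁` of conductor `≤ n` with `χ₁(1 + c′) ≠ 1`: the upper `b`-shell `P·w·u′·J_e` is
θ-irrelevant.  (Budget from exponents: `ord a ≥ r`, `ord b ≤ s − 1`, `ord c′ ≤ c − 1`, `s + s′ = c ≥ s + 1`, `r + s′ ≥ r′`, `2r + c ≥ n + s`.)
[cite: Roche1998, §4] [cite: Casselman1995, §6.3] [cite: Rogawski1990, §1.10 p. 9] -/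
theorem exists_upperShellB_witness (he0 : ∀ i, e i i = 0) (hsym : ∀ i j, e (Fin.rev j) (Fin.rev i) = e i j) {n : ℕ}
    {u : ↥(unitaryGroupOfForm σ J)} {a b c' t₁ : K}
    (hu : ((u : GL (Fin 3) K) : Matrix (Fin 3) (Fin 3) K) = !![1, a, b; 0, 1, -σ a; 0, 0, 1]) (hrel : b + σ b + a * σ a = 0) (hb0 : b ≠ 0)
    (hσc' : σ c' = c') (hvc' : Valued.v c' < 1) (ht₁ : t₁ + σ t₁ = 1) (hvt₁ : Valued.v t₁ ≤ 1)
    (H01 : Valued.v c' * Valued.v a ≤ Valued.v ϖ ^ e 0 1) (H02 : Valued.v c' * Valued.v b ≤ Valued.v ϖ ^ e 0 2)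
    (H10 : Valued.v c' * Valued.v a ≤ Valued.v ϖ ^ e 1 0 * Valued.v b) (H20 : Valued.v c' ≤ Valued.v ϖ ^ e 2 0 * Valued.v b)
    (Hn : Valued.v c' * (Valued.v a * Valued.v a) ≤ Valued.v ϖ ^ n * Valued.v b) :
    ∃ nb : ↥(unitaryGroupOfForm σ J),
      nb ∈ ((borelTriple σ J hJ).N).map (MulAut.conj (weylLongU σ hJ)).toMonoidHom ∧
      weylLongU σ hJ * nb * (weylLongU σ hJ)⁻¹ ∈ unipotentU σ J ∧
      u⁻¹ * nb * u ∈ Jg ∧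
      ∃ ε : K, Valued.v ε ≤ Valued.v ϖ ^ n ∧
        (((u⁻¹ * nb * u : ↥(unitaryGroupOfForm σ J)) : GL (Fin 3) K) : Matrix (Fin 3) (Fin 3) K) 0 0 = (1 + c') * (1 + ε) := by
  have hσb0 : σ b ≠ 0 := (map_ne_zero σ).2 hb0
  have hvb0 : Valued.v b ≠ 0 := (Valuation.ne_zero_iff _).2 hb0
  have hvbpos : 0 < Valued.v b := zero_lt_iff.2 hvb0
  have hvc'1 : Valued.v c' ≤ 1 := hvc'.le
  have hv1c' : Valued.v (1 + c') = 1 := Valuation.map_one_add_of_lt _ hvc'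
  have h1c'0 : 1 + c' ≠ 0 := fun h => by rw [h, map_zero] at hv1c'; exact zero_ne_one hv1c'
  -- `|a|² ≤ |b|` from `b + σb = −aσa`
  have haa : Valued.v a * Valued.v a ≤ Valued.v b := by
    have h : a * σ a = -(b + σ b) := by linear_combination hrel
    calc Valued.v a * Valued.v a = Valued.v (a * σ a) := by rw [map_mul, hvσ]
      _ = Valued.v (b + σ b) := by rw [h, Valuation.map_neg]
      _ ≤ max (Valued.v b) (Valued.v (σ b)) := Valuation.map_add _ _ _
      _ = Valued.v b := by rw [hvσ, max_self]
  -- the long-root coordinate `z̄` and the lower element `n̄ = ū(0, z̄)`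
  obtain ⟨zb, hzb⟩ : ∃ zb : K, zb = (c' * b + t₁ * c' * (a * σ a)) / (b * σ b) := ⟨_, rfl⟩
  have hzrel := longRoot_rel σ hσ (zb := zb) hrel hb0 hσc' ht₁ hzb
  obtain ⟨nb, hnb⟩ := exists_coe_eq_lower σ hJ hσ hzrel
  have hnb' : ((nb : GL (Fin 3) K) : Matrix (Fin 3) (Fin 3) K) = !![1, 0, 0; 0, 1, 0; zb, 0, 1] := by
    rw [hnb, map_zero, neg_zero]
  -- `n̄ ∈ N̄ = w N w` and `w n̄ w⁻¹ ∈ N`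
  have hlow : ∀ i j : Fin 3, i < j → ((nb : GL (Fin 3) K) : Matrix (Fin 3) (Fin 3) K) i j = 0 := by
    intro i j hij; rw [hnb']; fin_cases i <;> fin_cases j <;> simp at hij ⊢
  have hdiag : ∀ i : Fin 3, ((nb : GL (Fin 3) K) : Matrix (Fin 3) (Fin 3) K) i i = 1 := by
    intro i; rw [hnb']; fin_cases i <;> simp
  have hw : weylLongU σ hJ * weylLongU σ hJ = 1 := weylLongU_mul_weylLongU σ hJ
  have hnbN : nb ∈ ((borelTriple σ J hJ).N).map (MulAut.conj (weylLongU σ hJ)).toMonoidHom := by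
    refine ⟨weylLongU σ hJ * nb * weylLongU σ hJ, ?_, ?_⟩
    · rw [borelTriple_N]; exact weylLongU_mul_mul_weylLongU_mem_unipotentU σ hJ hlow hdiag
    · change weylLongU σ hJ * (weylLongU σ hJ * nb * weylLongU σ hJ) * (weylLongU σ hJ)⁻¹ = nb
      rw [inv_eq_of_mul_eq_one_right hw, ← mul_assoc, ← mul_assoc, hw, one_mul, mul_assoc, hw, mul_one]
  have hwN := weylLongU_mul_mul_inv_mem_unipotentU σ hJ hlow hdiag
  -- the error term `δ = t₁c′aσa∕b`: `|δ| ≤ |c′|` and `|δ| ≤ |ϖ|ⁿ`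
  have hzσb : zb * σ b = c' + t₁ * c' * (a * σ a) / b := longRoot_mul_conj σ hb0 hσb0 hzb
  have hvδb : Valued.v (t₁ * c' * (a * σ a) / b) * Valued.v b ≤ Valued.v c' * (Valued.v a * Valued.v a) := by
    rw [← map_mul, div_mul_cancel₀ _ hb0, map_mul, map_mul, map_mul, hvσ]
    calc Valued.v t₁ * Valued.v c' * (Valued.v a * Valued.v a) ≤ 1 * Valued.v c' * (Valued.v a * Valued.v a) := by gcongr
      _ = Valued.v c' * (Valued.v a * Valued.v a) := by rw [one_mul]
  have hvδ : Valued.v (t₁ * c' * (a * σ a) / b) ≤ Valued.v c' :=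
    (mul_le_mul_iff_left₀ hvbpos).1 (hvδb.trans (mul_le_mul' le_rfl haa))
  have hvδn : Valued.v (t₁ * c' * (a * σ a) / b) ≤ Valued.v ϖ ^ n := (mul_le_mul_iff_left₀ hvbpos).1 (hvδb.trans Hn)
  -- `|z̄σb| ≤ |c′|`, `|z̄|·|b| ≤ |c′|`
  have hvzσb : Valued.v (zb * σ b) ≤ Valued.v c' := by rw [hzσb]; exact Valuation.map_add_le _ le_rfl hvδ
  have hvzb : Valued.v zb * Valued.v b ≤ Valued.v c' := by rwa [map_mul, hvσ] at hvzσb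
  -- the nine entry bounds of `b₀ = !![1 + z̄σb, z̄σb·a, z̄σb·b; z̄σa, 1 + z̄σa·a, z̄σa·b; z̄, z̄a, 1 + z̄b]`
  have h00 : Valued.v (1 + zb * σ b) ≤ 1 := Valuation.map_add_le _ (by rw [map_one]) (hvzσb.trans hvc'1)
  have h01 : Valued.v (zb * σ b * a) ≤ Valued.v ϖ ^ e 0 1 := by
    rw [map_mul]; exact (mul_le_mul' hvzσb le_rfl).trans H01
  have h02 : Valued.v (zb * σ b * b) ≤ Valued.v ϖ ^ e 0 2 := by
    rw [map_mul]; exact (mul_le_mul' hvzσb le_rfl).trans H02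
  have hza : Valued.v zb * Valued.v a ≤ Valued.v ϖ ^ e 1 0 := by
    refine (mul_le_mul_iff_left₀ hvbpos).1 ?_
    calc Valued.v zb * Valued.v a * Valued.v b = Valued.v zb * Valued.v b * Valued.v a := mul_right_comm _ _ _
      _ ≤ Valued.v c' * Valued.v a := mul_le_mul' hvzb le_rfl
      _ ≤ Valued.v ϖ ^ e 1 0 * Valued.v b := H10
  have h10 : Valued.v (zb * σ a) ≤ Valued.v ϖ ^ e 1 0 := by rw [map_mul, hvσ]; exact hza
  have h11 : Valued.v (1 + zb * σ a * a) ≤ 1 := by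
    refine Valuation.map_add_le _ (by rw [map_one]) ?_
    rw [map_mul, map_mul, hvσ, mul_assoc]
    exact ((mul_le_mul' le_rfl haa).trans hvzb).trans hvc'1
  have h12 : Valued.v (zb * σ a * b) ≤ Valued.v ϖ ^ e 1 2 := by
    rw [show e 1 2 = e 0 1 from hsym 0 1, map_mul, map_mul, hvσ]
    calc Valued.v zb * Valued.v a * Valued.v b = Valued.v zb * Valued.v b * Valued.v a := mul_right_comm _ _ _
      _ ≤ Valued.v c' * Valued.v a := mul_le_mul' hvzb le_rfl
      _ ≤ Valued.v ϖ ^ e 0 1 := H01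
  have h20 : Valued.v zb ≤ Valued.v ϖ ^ e 2 0 := (mul_le_mul_iff_left₀ hvbpos).1 (hvzb.trans H20)
  have h21 : Valued.v (zb * a) ≤ Valued.v ϖ ^ e 2 1 := by rw [show e 2 1 = e 1 0 from hsym 1 0, map_mul]; exact hza
  have h22 : Valued.v (1 + zb * b) ≤ 1 := by
    refine Valuation.map_add_le _ (by rw [map_one]) ?_
    rw [map_mul]; exact hvzb.trans hvc'1
  have hcoe := coe_conj_lower_long_eq σ hJ hσ hu hnb hrel
  have hmem : u⁻¹ * nb * u ∈ Jg := by
    rw [hJg, hcoe]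
    intro i j
    fin_cases i <;> fin_cases j
    all_goals
      simp only [Fin.zero_eta, Fin.mk_one, Fin.reduceFinMk, Fin.isValue, Matrix.of_apply, Matrix.cons_val', Matrix.cons_val_zero,
        Matrix.cons_val_one, Matrix.cons_val, Matrix.empty_val', Matrix.cons_val_fin_one, he0, pow_zero]
    all_goals first | exact h00 | exact h01 | exact h02 | exact h10 | exact h11 | exact h12 | exact h20 | exact h21 | exact h22
  -- the `(0,0)` entry
  refine ⟨nb, hnbN, hwN, hmem, t₁ * c' * (a * σ a) / b / (1 + c'), ?_, ?_⟩
  · rw [map_div₀, hv1c', div_one]; exact hvδn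
  · have h := congr_fun (congr_fun hcoe 0) 0
    simp only [Fin.isValue, Matrix.of_apply, Matrix.cons_val', Matrix.cons_val_zero, Matrix.empty_val', Matrix.cons_val_fin_one] at h
    rw [h, hzσb]
    field_simp
    ring

end Valued

end Summit.HodgeConjecture.HodgeConjecture.Cruxes.H413.K2E3TwoDepthUpperShellWitnessB

end
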